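import Summits.RiemannHypothesis.RiemannHypothesis.Theorems.TiltedLandingLaw421R3BudgetRegimeA
import Summits.RiemannHypothesis.RiemannHypothesis.Theorems.TiltedLandingLaw421R3PairCoherence
import Summits.RiemannHypothesis.RiemannHypothesis.Theorems.TiltedLandingLaw421R3LightPairDrop

/-!
# K-2 budget, CASE (A) CLOSED on the nine numbers: `t_v ≥ 3/2` ⇒ the conclusion of `GeometricBudget 10 μ₀` (`μ₀ ≤ 1/2`) (C1 g35, W-08 ⟨33346⟩; D4b groundwork)

The binder list of `RhW08.LightPairDrop.GeometricBudget` (image G, RSV-44) VERBATIM, plus the case hypothesis `3/2 ≤ −Im v·Im K_v` and `μ₀ ≤ 1/2`,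
imply its conclusion with `C = 10`: `3 − 10(1+μ₀)/(Im v·κ) ≤ ((Im v² + Im z²) − (Im u₁² + Im u₂²))·κ²`.  Ingredients: §1 the EXPLICIT COHERENCE
`‖K_z − K_v‖ ≤ 6/Im v` (F's three term bounds `norm_self_diff_le` / `norm_cross_diff_eq` / `norm_conj_cross_diff_le` + drift `M‖z−v‖/(ab) ≤ 1/a`), the
sign `Im K_z ≤ −1/(2 Im z)` (#1176 `im_inv_sub_conj_self`, `im_pairField`, `pairPull_nonpos_iff`), §2 the z-disc costs at most its doors
(`zdisc_doors`: H (I1) with `t_z > 0`, centre height in `[0, Im z]`), §3 the v-disc pays `3 − 3/λ` (image I `vdisc_regimeA`) and the z-doors cost `≤ 5/λ`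
(`λ = Im v·κ`, via `a‖K_z‖ ≥ λ − 13/2`).  So the certified check of `GeometricBudget 10 (1/2)` (instr-1 E2) may assume `t_v ≤ 3/2` (memo v2 §4 (A), (L1)).
STATUS: support; `GeometricBudget 10 (1/2)` is NOT proved (cases `t_v < 3/2` open).  Nothing here bears on the truth of RH; RH is not proved; 33346 / 33347 OPEN. -/

namespace RhW08.BudgetCaseA

open Complex
open scoped ComplexConjugate
open RhW08.BudgetAlgebra (energy_drop_closedDisc neg_im_mul_le)
open RhW08.BudgetRegimeA (vdisc_regimeA)
open RhW08.LightIsolatedChild (im_newtonPoint)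
open RhW08.LightPairDrop (im_mul_norm_ge)
open RhW08.UncoveredSign (pairPull im_pairField im_inv_sub_conj_self pairPull_nonpos_iff)
open RhW08.PairCoherence (norm_self_diff_le norm_cross_diff_eq norm_conj_cross_diff_le)

/-! ## §1 Explicit coherence and the sign at `z` -/

/-- §1 EXPLICIT COHERENCE: for a separated touching pair `0 < Im v < Im z`, `|Re v − Re z| ≤ Im v + Im z`, `Im v ≤ 2‖v − z‖`, explicit fields
`K_w = (w−w̄)⁻¹ + (w−p)⁻¹ + (w−p̄)⁻¹ + R_w` with drift `‖R_z − R_v‖ ≤ M‖z−v‖/(Im v·Im z)`, `M ≤ 1/2`: `‖K_z − K_v‖ ≤ 6/Im v`. -/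
theorem explicit_coherence {v z Rv Rz Kv Kz : ℂ} {M : ℝ} (ha : 0 < v.im) (hab : v.im < z.im) (ht : |v.re - z.re| ≤ v.im + z.im)
    (hsep : v.im ≤ 2 * ‖v - z‖) (hM : M ≤ 1 / 2)
    (hKv : Kv = (v - conj v)⁻¹ + (v - z)⁻¹ + (v - conj z)⁻¹ + Rv) (hKz : Kz = (z - conj z)⁻¹ + (z - v)⁻¹ + (z - conj v)⁻¹ + Rz)
    (hR : ‖Rz - Rv‖ ≤ M * ‖z - v‖ / (v.im * z.im)) : ‖Kz - Kv‖ ≤ 6 / v.im := by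
  have hb : 0 < z.im := ha.trans hab
  have e : Kz - Kv = ((z - conj z)⁻¹ - (v - conj v)⁻¹) + ((z - v)⁻¹ - (v - z)⁻¹) + ((z - conj v)⁻¹ - (v - conj z)⁻¹) + (Rz - Rv) := by
    rw [hKv, hKz]; ring
  rw [e]
  have h1 := (norm_self_diff_le ha hab.le).2
  have h2 := norm_cross_diff_eq v z
  have h3 := norm_conj_cross_diff_le ha hb
  have hvz : 0 < ‖z - v‖ := by rw [norm_sub_rev]; linarith
  have h2' : 2 / ‖z - v‖ ≤ 4 / v.im := by
    rw [norm_sub_rev] at hvz ⊢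
    rw [div_le_div_iff₀ hvz ha]; nlinarith
  have h3' : 1 / (v.im + z.im) ≤ 1 / (2 * v.im) := one_div_le_one_div_of_le (by positivity) (by linarith)
  have hzv : ‖z - v‖ ≤ 2 * z.im := by
    have h5 := Complex.norm_le_abs_re_add_abs_im (z - v)
    rw [sub_re, sub_im, abs_sub_comm z.re v.re, abs_of_pos (by linarith : 0 < z.im - v.im)] at h5
    linarith
  have h4 : M * ‖z - v‖ / (v.im * z.im) ≤ 1 / v.im := by
    rw [div_le_div_iff₀ (by positivity) ha]
    have h6 : M * ‖z - v‖ ≤ (1 / 2) * (2 * z.im) := mul_le_mul hM hzv (norm_nonneg _) (by norm_num)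
    nlinarith [mul_pos ha hb]
  have hsum : 1 / (2 * v.im) + 4 / v.im + 1 / (2 * v.im) + 1 / v.im = 6 / v.im := by
    field_simp; ring
  set A : ℂ := (z - conj z)⁻¹ - (v - conj v)⁻¹
  set B : ℂ := (z - v)⁻¹ - (v - z)⁻¹
  set C' : ℂ := (z - conj v)⁻¹ - (v - conj z)⁻¹
  set D : ℂ := Rz - Rv
  have t1 := norm_add_le (A + B + C') D
  have t2 := norm_add_le (A + B) C'
  have t3 := norm_add_le A B
  linarith

/-- §1 the SIGN AT THE TALLER STATE: `Im K_z ≤ −1/(2 Im z)` (the mate term; the pair pull at the taller state and `Im R_z` are `≤ 0`). -/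
theorem im_Kz_le {v z Rz Kz : ℂ} (ha : 0 < v.im) (hab : v.im < z.im)
    (hKz : Kz = (z - conj z)⁻¹ + (z - v)⁻¹ + (z - conj v)⁻¹ + Rz) (hRz : Rz.im ≤ 0) : Kz.im ≤ -(1 / (2 * z.im)) := by
  have hb : 0 < z.im := ha.trans hab
  have hzv : z ≠ v := fun e => by rw [e] at hab; exact lt_irrefl _ hab
  have hP : pairPull z v ≤ 0 := (pairPull_nonpos_iff hb ha hzv).2 (by nlinarith [sq_nonneg (z.re - v.re)])
  have e : Kz.im = -(1 / (2 * z.im)) + pairPull z v + Rz.im := by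
    rw [hKz, add_im, add_assoc (z - conj z)⁻¹, add_im, im_inv_sub_conj_self, im_pairField]
  rw [e]; linarith

/-! ## §2 The z-disc costs at most its doors -/

/-- §2 with `Im K < 0`, `1 ≤ Im z·‖K‖` and a child in the closed sharp disc of radius `δ = (9/5)(μ₀/(Im z‖K‖)²)/‖K‖`:
`−κ₂·(2·Im z·δ + δ²) ≤ (Im z² − Im u²)·κ₂` for any weight `κ₂ ≥ 0` (H (I1); the main terms `2t/n² − t²/(b²n⁴) ≥ 0`, centre height in `[0, Im z]`). -/
theorem zdisc_doors {z K u : ℂ} {μ₀ κ₂ : ℝ} (hz : 0 < z.im) (hκ : 0 ≤ κ₂) (hμ0 : 0 ≤ μ₀) (hKim : K.im < 0) (hL1 : 1 ≤ z.im * ‖K‖)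
    (hd : ‖u - (z - K⁻¹)‖ ≤ (9 / 5) * (μ₀ / (z.im * ‖K‖) ^ 2) / ‖K‖) :
    -(κ₂ * (2 * z.im * ((9 / 5) * (μ₀ / (z.im * ‖K‖) ^ 2) / ‖K‖) + ((9 / 5) * (μ₀ / (z.im * ‖K‖) ^ 2) / ‖K‖) ^ 2)) ≤
      (z.im ^ 2 - u.im ^ 2) * κ₂ := by
  set b := z.im with hb
  set n := ‖K‖ with hn
  set t := -(b * K.im) with htdef
  set δ := (9 / 5) * (μ₀ / (b * n) ^ 2) / n with hδ
  have hK0 : K ≠ 0 := fun h => by rw [h] at hKim; simp at hKim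
  have hn0 : 0 < n := norm_pos_iff.mpr hK0
  have ht0 : 0 < t := by rw [htdef]; nlinarith
  have htL : t ≤ b * n := neg_im_mul_le hz.le
  have hδ0 : 0 ≤ δ := by positivity
  have htbn : t ≤ b ^ 2 * n ^ 2 := by nlinarith [mul_nonneg hz.le hn0.le]
  have hc : |(z - K⁻¹).im| ≤ b := by
    rw [im_newtonPoint]
    have e : K.im = -t / b := by rw [htdef]; field_simp
    have h1 : 0 ≤ t / (b * n ^ 2) := by positivity
    have h2 : t / (b * n ^ 2) ≤ b := by
      rw [div_le_iff₀ (by positivity)]; nlinarith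
    have e2 : b + K.im / n ^ 2 = b - t / (b * n ^ 2) := by rw [e]; field_simp; ring
    rw [← hb, e2, abs_le]
    constructor <;> linarith
  have hdrop := energy_drop_closedDisc hd
  have hmain : 0 ≤ 2 * (-(z.im * K.im)) / ‖K‖ ^ 2 - K.im ^ 2 / ‖K‖ ^ 4 := by
    have e1 : 2 * (-(z.im * K.im)) / ‖K‖ ^ 2 - K.im ^ 2 / ‖K‖ ^ 4 = t * (2 * b ^ 2 * n ^ 2 - t) / (b ^ 2 * n ^ 4) := by
      rw [htdef, ← hn, ← hb]; field_simp; ring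
    rw [e1]
    apply div_nonneg (mul_nonneg ht0.le (by nlinarith)) (by positivity)
  have h3 : 2 * |(z - K⁻¹).im| * δ ≤ 2 * b * δ := by nlinarith [abs_nonneg ((z - K⁻¹).im)]
  have h4 : -(2 * b * δ + δ ^ 2) ≤ b ^ 2 - u.im ^ 2 := by linarith
  have h5 := mul_le_mul_of_nonneg_right h4 hκ
  linarith

/-! ## §3 Case (A) of the budget -/

/-- §3 the z-doors in `λ`-currency (pure real): `λ ≥ 30`, `(47/60)λ ≤ m ≤ q`, `0 ≤ μ₀ ≤ 1/2` ⇒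
`(18/5)μ₀λ²/(q m²) + (81/25)μ₀²λ²/(q⁴ m²) ≤ 5/λ` (`m = Im v·‖K_z‖`, `q = Im z·‖K_z‖`). -/
theorem zdoors_real {lam m q μ₀ : ℝ} (hlam : 30 ≤ lam) (hm47 : (47 / 60) * lam ≤ m) (hqm : m ≤ q) (hμ0 : 0 ≤ μ₀) (hμ : μ₀ ≤ 1 / 2) :
    (18 / 5) * μ₀ * lam ^ 2 / (q * m ^ 2) + (81 / 25) * μ₀ ^ 2 * lam ^ 2 / (q ^ 4 * m ^ 2) ≤ 5 / lam := by
  have hlam0 : 0 < lam := by linarith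
  have hm0 : 0 < m := by linarith
  have hq0 : 0 < q := by linarith
  have hm3 : (103823 / 216000) * lam ^ 3 ≤ m ^ 3 := by
    have := pow_le_pow_left₀ (by positivity) hm47 3
    nlinarith
  have hlam3 : 27000 ≤ lam ^ 3 := by nlinarith [pow_le_pow_left₀ (by norm_num) hlam 3]
  have hm2 : 0 < m ^ 2 := by positivity
  have h1 : (18 / 5) * μ₀ * lam ^ 2 / (q * m ^ 2) ≤ (18 / 5) * μ₀ * lam ^ 2 / (m * m ^ 2) :=
    div_le_div_of_nonneg_left (by positivity) (mul_pos hm0 hm2) (mul_le_mul_of_nonneg_right hqm hm2.le)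
  have h1' : (18 / 5) * μ₀ * lam ^ 2 / (m * m ^ 2) ≤ 4 / lam := by
    rw [div_le_div_iff₀ (mul_pos hm0 hm2) hlam0]
    have : μ₀ * lam ^ 2 * lam ≤ (1 / 2) * lam ^ 3 := by nlinarith [pow_pos hlam0 3]
    nlinarith
  have hq4 : m ^ 4 ≤ q ^ 4 := pow_le_pow_left₀ hm0.le hqm 4
  have h2 : (81 / 25) * μ₀ ^ 2 * lam ^ 2 / (q ^ 4 * m ^ 2) ≤ (81 / 25) * μ₀ ^ 2 * lam ^ 2 / (m ^ 4 * m ^ 2) :=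
    div_le_div_of_nonneg_left (by positivity) (by positivity) (mul_le_mul_of_nonneg_right hq4 hm2.le)
  have h2' : (81 / 25) * μ₀ ^ 2 * lam ^ 2 / (m ^ 4 * m ^ 2) ≤ 1 / lam := by
    rw [div_le_div_iff₀ (by positivity) hlam0]
    have hμ2 : μ₀ ^ 2 ≤ 1 / 4 := by nlinarith
    have e6 : m ^ 4 * m ^ 2 = m ^ 3 * m ^ 3 := by ring
    have h6 : (103823 / 216000) * lam ^ 3 * ((103823 / 216000) * 27000) ≤ m ^ 3 * m ^ 3 :=
      mul_le_mul hm3 (by nlinarith) (by positivity) (by positivity)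
    rw [e6]
    nlinarith [mul_le_mul_of_nonneg_right hμ2 (by positivity : (0:ℝ) ≤ lam ^ 2 * lam), pow_pos hlam0 3]
  have h5 : 4 / lam + 1 / lam = 5 / lam := by ring
  linarith

set_option maxHeartbeats 400000 in
/-- ★★ §3 **CASE (A) OF `GeometricBudget 10 μ₀` (`μ₀ ≤ 1/2`)**: a SUB-LIST of the binders of `RhW08.LightPairDrop.GeometricBudget` (verbatim; `Im R_v ≤ 0` and
the z-floor are not needed), plus the case hypothesis `3/2 ≤ −Im v·Im K_v`, give
its conclusion with `C = 10`: the v-disc pays `3 − 3/λ` (`vdisc_regimeA`), the z-disc costs `≤ 5/λ` (`zdisc_doors`, coherence, `zdoors_real`), `8 ≤ 10(1+μ₀)`. -/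
theorem budget_caseA {v z Rv Rz Kv Kz u₁ u₂ : ℂ} {M μ₀ : ℝ} (hμ : μ₀ ≤ 1 / 2)
    (hv : 0 < v.im) (hvz : v.im < z.im) (ht : |v.re - z.re| ≤ v.im + z.im) (hsep : v.im ≤ 2 * ‖v - z‖) (hM0 : 0 ≤ M) (hMμ : M ≤ μ₀)
    (hKv : Kv = (v - conj v)⁻¹ + (v - z)⁻¹ + (v - conj z)⁻¹ + Rv) (hKz : Kz = (z - conj z)⁻¹ + (z - v)⁻¹ + (z - conj v)⁻¹ + Rz)
    (hRz : Rz.im ≤ 0) (hR : ‖Rz - Rv‖ ≤ M * ‖z - v‖ / (v.im * z.im))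
    (hflv : 30 ≤ v.im * ‖Kv + I / (2 * (v.im : ℂ))‖)
    (hd₁ : ‖u₁ - (v - Kv⁻¹)‖ ≤ (9 / 5) * (μ₀ / (v.im * ‖Kv‖) ^ 2) / ‖Kv‖)
    (hd₂ : ‖u₂ - (z - Kz⁻¹)‖ ≤ (9 / 5) * (μ₀ / (z.im * ‖Kz‖) ^ 2) / ‖Kz‖)
    (hA : 3 / 2 ≤ -(v.im * Kv.im)) :
    3 - 10 * (1 + μ₀) / (v.im * ‖Kv + I / (2 * (v.im : ℂ))‖) ≤
      ((v.im ^ 2 + z.im ^ 2) - (u₁.im ^ 2 + u₂.im ^ 2)) * ‖Kv + I / (2 * (v.im : ℂ))‖ ^ 2 := by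
  have hb : 0 < z.im := hv.trans hvz
  have hμ0 : 0 ≤ μ₀ := hM0.trans hMμ
  set a := v.im with ha
  set b := z.im with hbdef
  set κ := ‖Kv + I / (2 * (a : ℂ))‖ with hκ
  set nz := ‖Kz‖ with hnz
  have hlam30 : 30 ≤ a * κ := hflv
  have hlam0 : 0 < a * κ := by linarith
  -- the v-disc pays 3 − 3/λ
  have hV := vdisc_regimeA (u := u₁) hv hμ0 hμ hflv hA hd₁
  -- sign and size at z
  have hKzim : Kz.im < 0 := by
    have h := im_Kz_le hv hvz hKz hRz
    have : 0 < 1 / (2 * b) := by positivity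
    linarith
  have hKz0 : Kz ≠ 0 := fun h => by rw [h] at hKzim; simp at hKzim
  have hnz0 : 0 < nz := norm_pos_iff.mpr hKz0
  have hcoh : ‖Kz - Kv‖ ≤ 6 / a := explicit_coherence hv hvz ht hsep (hMμ.trans hμ) hKv hKz hR
  have hnv : a * κ - 1 / 2 ≤ a * ‖Kv‖ := im_mul_norm_ge hv
  have hm : a * κ - 13 / 2 ≤ a * nz := by
    have h1 : ‖Kv‖ - ‖Kz‖ ≤ ‖Kv - Kz‖ := norm_sub_norm_le _ _
    rw [norm_sub_rev] at h1
    have h2 : a * (‖Kv‖ - nz) ≤ a * (6 / a) := mul_le_mul_of_nonneg_left (h1.trans hcoh) hv.le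
    have h3 : a * (6 / a) = 6 := by field_simp
    nlinarith
  have hm47 : (47 / 60) * (a * κ) ≤ a * nz := by linarith
  have hqm : a * nz ≤ b * nz := by nlinarith
  have hL1 : 1 ≤ b * nz := by linarith
  -- the z-disc costs at most its doors, and the doors cost ≤ 5/λ
  have hZ := zdisc_doors (κ₂ := κ ^ 2) hb (sq_nonneg κ) hμ0 hKzim hL1 hd₂
  have e : κ ^ 2 * (2 * b * ((9 / 5) * (μ₀ / (b * nz) ^ 2) / nz) + ((9 / 5) * (μ₀ / (b * nz) ^ 2) / nz) ^ 2) =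
      (18 / 5) * μ₀ * (a * κ) ^ 2 / ((b * nz) * (a * nz) ^ 2) + (81 / 25) * μ₀ ^ 2 * (a * κ) ^ 2 / ((b * nz) ^ 4 * (a * nz) ^ 2) := by
    field_simp
    ring
  have hT := zdoors_real hlam30 hm47 hqm hμ0 hμ
  rw [← e] at hT
  -- assemble
  have hsplit : ((a ^ 2 + b ^ 2) - (u₁.im ^ 2 + u₂.im ^ 2)) * κ ^ 2 = (a ^ 2 - u₁.im ^ 2) * κ ^ 2 + (b ^ 2 - u₂.im ^ 2) * κ ^ 2 := by ring
  have hC : 10 / (a * κ) ≤ 10 * (1 + μ₀) / (a * κ) := by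
    apply div_le_div_of_nonneg_right _ hlam0.le
    nlinarith
  have h8 : 3 / (a * κ) + 5 / (a * κ) ≤ 10 / (a * κ) := by
    rw [← add_div]; exact div_le_div_of_nonneg_right (by norm_num) hlam0.le
  rw [hsplit]
  linarith

end RhW08.BudgetCaseA
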